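import Literature.AlgebraicGeometry.Frobenioids.ElementaryFrobenioid
import Literature.AlgebraicGeometry.Frobenioids.ModelFrobenioid
import HarnessLib

/-!
# Frobenioids I, §5: the functor from the model Frobenioid to `F_Φ`, its zero section (Thm. 5.2 (i), (iii))

Mochizuki, *The geometry of Frobenioids I*, Kyushu J. Math. **62** (2008), §5, Theorem 5.2,
kurims pp. 100–101 [cite: MochizukiFrdI2008, Thm. 5.2(i) p.100].

* Thm. 5.2 (i), last sentence: "the Frobenius degree, projection to `D`, and zero divisor determine
  a functor `C → F_Φ`" — here `ModelFrobenioid.toElem : ModelFrobenioid Φ B DivB ⥤ ElemFrobenioid Φ`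
  (the pre-Frobenioid structure of the model Frobenioid), with its three projections identified.
* Proof of Thm. 5.2 (iii), p. 101: "the objects `A = (A_D, α)` such that `α = 0` are
  Frobenius-trivial, and these objects, together with the morphisms … such that `Div(φ) = 0`,
  `u_φ = 1`, determine a base-Frobenius pair of `C`": the zero section `D → C`, `A_D ↦ (A_D, 0)`, the
  degree-`d` Frobenius endomorphisms `(d, id, 0, 0)` and the homomorphism
  `ℕ_{≥1} → End((A_D, 0))` they form (a section of `deg_Fr` by base-identity arrows).
Also the general functoriality "`Φ ↦ F_Φ` is functorial with respect to homomorphisms of functors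
valued in monoids `Φ → Φ'`" (Def. 1.1 (iii), p. 20) as `ElemFrobenioid.mapNatTrans`, and the monoid
`0_D` (all values the one-element monoid, Prop. 4.4 (i) p. 83) with `F_Φ → F_{0_D}`.
Multiplicative notation (`α = 0 ↦ 1`, `u_φ = 1 ↦ 1`); diagrammatic composition.
-/

noncomputable section

namespace Literature.AlgebraicGeometry.Frobenioids

open CategoryTheory Opposite

universe w v u

variable {D : Type u} [Category.{v} D]

/-! ### `Φ ↦ F_Φ` is functorial (Def. 1.1 (iii)); the monoid `0_D` -/

namespace ElemFrobenioid

/-- The functor `F_Φ → F_{Φ'}` induced by a homomorphism `η : Φ → Φ'` of monoids on `D` ("the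
assignment `Φ ↦ F_Φ` is functorial with respect to homomorphisms of functors valued in monoids",
Def. 1.1 (iii), p. 20): identity on objects, `(φ_D, Z_φ, n_φ) ↦ (φ_D, η(Z_φ), n_φ)`.
[cite: MochizukiFrdI2008, Def. 1.1(iii) p.20] -/
def mapNatTrans {Φ Φ' : Dᵒᵖ ⥤ CommMonCat.{w}} (η : Φ ⟶ Φ') : ElemFrobenioid Φ ⥤ ElemFrobenioid Φ' where
  obj A := of Φ' A.base
  map {A B} φ := homMk (show A.base ⟶ B.base from Base (Φ := Φ) φ)
    ((η.app (op A.base)).hom (Div (Φ := Φ) φ)) (degFr (Φ := Φ) φ)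
  map_id _ := Hom.ext rfl (map_one _) rfl
  map_comp {A B B'} φ ψ := Hom.ext rfl
    (by
      show (η.app _).hom (pull Φ (Base (Φ := Φ) φ) (Div (Φ := Φ) ψ) * Div (Φ := Φ) φ ^ (degFr (Φ := Φ) ψ : ℕ)) =
        pull Φ' (Base (Φ := Φ) φ) ((η.app _).hom (Div (Φ := Φ) ψ)) *
          ((η.app _).hom (Div (Φ := Φ) φ)) ^ (degFr (Φ := Φ) ψ : ℕ)
      have hn := congrArg (fun g => (CommMonCat.Hom.hom g) (Div (Φ := Φ) ψ))
        (η.naturality (Base (Φ := Φ) φ).op)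
      simp only [CommMonCat.hom_comp, MonoidHom.coe_comp, Function.comp_apply] at hn
      rw [map_mul, map_pow]
      exact congrArg (· * _) hn)
    rfl

/-- `mapNatTrans η` preserves `Base`. [cite: MochizukiFrdI2008, Def. 1.1(iii) p.20] -/
@[simp] theorem base_mapNatTrans_map {Φ Φ' : Dᵒᵖ ⥤ CommMonCat.{w}} (η : Φ ⟶ Φ')
    {A B : ElemFrobenioid Φ} (φ : A ⟶ B) :
    Base ((mapNatTrans η).map φ) = (show A.base ⟶ B.base from Base φ) := rfl

/-- `mapNatTrans η` applies `η` to `Div`. [cite: MochizukiFrdI2008, Def. 1.1(iii) p.20] -/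
@[simp] theorem div_mapNatTrans_map {Φ Φ' : Dᵒᵖ ⥤ CommMonCat.{w}} (η : Φ ⟶ Φ')
    {A B : ElemFrobenioid Φ} (φ : A ⟶ B) :
    Div ((mapNatTrans η).map φ) = (η.app (op A.base)).hom (Div φ) := rfl

/-- `mapNatTrans η` preserves `deg_Fr`. [cite: MochizukiFrdI2008, Def. 1.1(iii) p.20] -/
@[simp] theorem degFr_mapNatTrans_map {Φ Φ' : Dᵒᵖ ⥤ CommMonCat.{w}} (η : Φ ⟶ Φ')
    {A B : ElemFrobenioid Φ} (φ : A ⟶ B) : degFr ((mapNatTrans η).map φ) = degFr φ := rfl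

/-- `mapNatTrans η` commutes strictly with the projections to `D`. [cite: MochizukiFrdI2008, Def. 1.1(iii) p.20] -/
theorem mapNatTrans_comp_baseFunctor {Φ Φ' : Dᵒᵖ ⥤ CommMonCat.{w}} (η : Φ ⟶ Φ') :
    mapNatTrans η ⋙ baseFunctor Φ' = baseFunctor Φ := rfl

end ElemFrobenioid

variable (D) in
/-- The monoid `0_D` on `D`: "the monoid on `D` all of whose values on objects of `D` are equal to the
monoid with one element" (Prop. 4.4 (i), p. 83), so that `F_{0_D}` is `D × (one-object category of
`ℕ_{≥1})`. [cite: MochizukiFrdI2008, Prop. 4.4(i) p.83] -/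
def zeroMonoid : Dᵒᵖ ⥤ CommMonCat.{w} := (Functor.const _).obj (CommMonCat.of PUnit)

/-- The unique homomorphism `Φ → 0_D` of monoids on `D`. [cite: MochizukiFrdI2008, Prop. 4.4(i) p.83] -/
def toZeroMonoid (Φ : Dᵒᵖ ⥤ CommMonCat.{w}) : Φ ⟶ zeroMonoid D where
  app A := CommMonCat.ofHom (1 : Φ.obj A →* PUnit)
  naturality A B f := by apply CommMonCat.hom_ext; ext; rfl

/-! ### The functor `ModelFrobenioid Φ B DivB ⥤ F_Φ` (Thm. 5.2 (i)) -/

namespace ModelFrobenioid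

variable {Φ B : Dᵒᵖ ⥤ CommMonCat.{w}} {DivB : B ⟶ monoidGp Φ}

variable (Φ B DivB) in
/-- **Thm. 5.2 (i)**: "the Frobenius degree, projection to `D`, and zero divisor determine a functor
`C → F_Φ`" — the pre-Frobenioid structure of the model Frobenioid.
[cite: MochizukiFrdI2008, Thm. 5.2(i) p.100] -/
def toElem : ModelFrobenioid Φ B DivB ⥤ ElemFrobenioid Φ where
  obj X := ElemFrobenioid.of Φ X.base
  map φ := ElemFrobenioid.homMk (baseMap φ) (div φ) (degFr φ)
  map_id _ := ElemFrobenioid.Hom.ext rfl rfl rfl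
  map_comp _ _ := ElemFrobenioid.Hom.ext rfl rfl (mul_comm _ _)

/-- `toElem` on objects: `(A_D, α) ↦ A_D`. [cite: MochizukiFrdI2008, Thm. 5.2(i) p.100] -/
@[simp] theorem toElem_obj_base (X : ModelFrobenioid Φ B DivB) : ((toElem Φ B DivB).obj X).base = X.base := rfl

/-- `Base` through `toElem` is `Base`. [cite: MochizukiFrdI2008, Thm. 5.2(i) p.100] -/
@[simp] theorem base_toElem_map {X Y : ModelFrobenioid Φ B DivB} (φ : X ⟶ Y) :
    ElemFrobenioid.Base ((toElem Φ B DivB).map φ) = baseMap φ := rfl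

/-- `Div` through `toElem` is `Div`. [cite: MochizukiFrdI2008, Thm. 5.2(i) p.100] -/
@[simp] theorem div_toElem_map {X Y : ModelFrobenioid Φ B DivB} (φ : X ⟶ Y) :
    ElemFrobenioid.Div ((toElem Φ B DivB).map φ) = div φ := rfl

/-- `deg_Fr` through `toElem` is `deg_Fr`. [cite: MochizukiFrdI2008, Thm. 5.2(i) p.100] -/
@[simp] theorem degFr_toElem_map {X Y : ModelFrobenioid Φ B DivB} (φ : X ⟶ Y) :
    ElemFrobenioid.degFr ((toElem Φ B DivB).map φ) = degFr φ := rfl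

/-- `toElem` followed by `F_Φ → D` is the projection `baseFunctor`. [cite: MochizukiFrdI2008, Thm. 5.2(i) p.100] -/
theorem toElem_comp_baseFunctor :
    toElem Φ B DivB ⋙ ElemFrobenioid.baseFunctor Φ = baseFunctor Φ B DivB := rfl

/-! ### The zero section and the Frobenius endomorphisms (proof of Thm. 5.2 (iii), p. 101) -/

variable (Φ B DivB) in
/-- The object `(A_D, 0)` over `A_D ∈ Ob(D)` ("the objects `A = (A_D, α)` such that `α = 0`").
[cite: MochizukiFrdI2008, Thm. 5.2 p.101] -/
abbrev zeroObj (A : D) : ModelFrobenioid Φ B DivB := ⟨A, 1⟩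

/-- The morphism `(d, f, 0, 0) : (A_D, 0) → (A'_D, 0)` over `f : A_D → A'_D` with Frobenius degree `d`
("the morphisms … such that `Div(φ) = 0`, `u_φ = 1`"). [cite: MochizukiFrdI2008, Thm. 5.2 p.101] -/
def zeroHom {A A' : D} (d : ℕ+) (f : A ⟶ A') : zeroObj Φ B DivB A ⟶ zeroObj Φ B DivB A' where
  degFr := d
  base := f
  div := 1
  unit := 1
  rel := by
    change (1 : Algebra.GrothendieckGroup (Φ.obj (op A))) ^ (d : ℕ) *
        Algebra.GrothendieckGroup.of (1 : Φ.obj (op A)) = pullGp Φ f 1 * divB Φ B DivB (op A) 1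
    rw [one_pow, map_one, map_one, map_one, mul_one]

/-- Components of `zeroHom`. [cite: MochizukiFrdI2008, Thm. 5.2 p.101] -/
@[simp] theorem degFr_zeroHom {A A' : D} (d : ℕ+) (f : A ⟶ A') :
    degFr (zeroHom (Φ := Φ) (B := B) (DivB := DivB) d f) = d := rfl

/-- Components of `zeroHom`. [cite: MochizukiFrdI2008, Thm. 5.2 p.101] -/
@[simp] theorem baseMap_zeroHom {A A' : D} (d : ℕ+) (f : A ⟶ A') :
    baseMap (zeroHom (Φ := Φ) (B := B) (DivB := DivB) d f) = f := rfl

/-- Components of `zeroHom`. [cite: MochizukiFrdI2008, Thm. 5.2 p.101] -/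
@[simp] theorem div_zeroHom {A A' : D} (d : ℕ+) (f : A ⟶ A') :
    div (zeroHom (Φ := Φ) (B := B) (DivB := DivB) d f) = 1 := rfl

/-- Components of `zeroHom`. [cite: MochizukiFrdI2008, Thm. 5.2 p.101] -/
@[simp] theorem unit_zeroHom {A A' : D} (d : ℕ+) (f : A ⟶ A') :
    unit (zeroHom (Φ := Φ) (B := B) (DivB := DivB) d f) = 1 := rfl

/-- `zeroHom 1 (𝟙 A)` is the identity. [cite: MochizukiFrdI2008, Thm. 5.2 p.101] -/
theorem zeroHom_id (A : D) : zeroHom (Φ := Φ) (B := B) (DivB := DivB) 1 (𝟙 A) = 𝟙 (zeroObj Φ B DivB A) :=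
  rfl

/-- `zeroHom` composes: degrees multiply, bases compose. [cite: MochizukiFrdI2008, Thm. 5.2 p.101] -/
theorem zeroHom_comp {A A' A'' : D} (d d' : ℕ+) (f : A ⟶ A') (g : A' ⟶ A'') :
    zeroHom (Φ := Φ) (B := B) (DivB := DivB) d f ≫ zeroHom d' g = zeroHom (d' * d) (f ≫ g) := by
  apply hom_ext
  · rfl
  · rfl
  · change (Φ.map f.op).hom 1 * 1 ^ (d' : ℕ) = 1
    rw [map_one, one_pow, mul_one]
  · change (B.map f.op).hom 1 * 1 ^ (d' : ℕ) = 1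
    rw [map_one, one_pow, mul_one]

variable (Φ B DivB) in
/-- The zero section `D → C`, `A_D ↦ (A_D, 0)`, `f ↦ (1, f, 0, 0)` — the linear, divisor-free,
unit-free lifts of the arrows of `D` (the `P` of the base-Frobenius pair in the proof of
Thm. 5.2 (iii)). [cite: MochizukiFrdI2008, Thm. 5.2 p.101] -/
def zeroSection : D ⥤ ModelFrobenioid Φ B DivB where
  obj A := zeroObj Φ B DivB A
  map f := zeroHom 1 f
  map_id A := zeroHom_id A
  map_comp f g := (zeroHom_comp 1 1 f g).symm

/-- The zero section is a section of the projection to `D` (strictly). [cite: MochizukiFrdI2008, Thm. 5.2 p.101] -/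
theorem zeroSection_comp_baseFunctor : zeroSection Φ B DivB ⋙ baseFunctor Φ B DivB = 𝟭 D := rfl

/-- `d ↦ (d, id, 0, 0)`: the homomorphism `ℕ_{≥1} → End((A_D, 0))` of Frobenius endomorphisms
(the `F` of the base-Frobenius pair in the proof of Thm. 5.2 (iii)). [cite: MochizukiFrdI2008, Thm. 5.2 p.101] -/
def frobeniusEndHom (A : D) : ℕ+ →* End (zeroObj Φ B DivB A) where
  toFun d := zeroHom d (𝟙 A)
  map_one' := zeroHom_id A
  map_mul' d d' := by
    change zeroHom (d * d') (𝟙 A) = zeroHom d' (𝟙 A) ≫ zeroHom d (𝟙 A)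
    rw [zeroHom_comp, Category.id_comp]

/-- The Frobenius endomorphisms form a section of `deg_Fr`: `deg_Fr((d, id, 0, 0)) = d`.
[cite: MochizukiFrdI2008, Thm. 5.2 p.101] -/
theorem degFr_frobeniusEndHom (A : D) (d : ℕ+) :
    degFr (frobeniusEndHom (Φ := Φ) (B := B) (DivB := DivB) A d) = d := rfl

/-- The Frobenius endomorphisms are base-identity: `Base((d, id, 0, 0)) = id`.
[cite: MochizukiFrdI2008, Thm. 5.2 p.101] -/
theorem baseMap_frobeniusEndHom (A : D) (d : ℕ+) :
    baseMap (frobeniusEndHom (Φ := Φ) (B := B) (DivB := DivB) A d) = 𝟙 A := rfl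

/-- The Frobenius endomorphisms are isometric: `Div((d, id, 0, 0)) = 0`.
[cite: MochizukiFrdI2008, Thm. 5.2 p.101] -/
theorem div_frobeniusEndHom (A : D) (d : ℕ+) :
    div (frobeniusEndHom (Φ := Φ) (B := B) (DivB := DivB) A d) = 1 := rfl

end ModelFrobenioid

end Literature.AlgebraicGeometry.Frobenioids
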